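import Mathlib
import HarnessLib
import Summits.HubbardSuperconductivity.HubbardSuperconductivity.Theorems.KLProgrammeKLRegimeEngineE4ScaleDoor
import Summits.HubbardSuperconductivity.HubbardSuperconductivity.Theorems.KLProgrammeKLRegimeSectorSliceRowsMoment

/-!
# KL programme — K3 ENGINE child (`KLRegimeEngineV17F2`, stmt-HubbardSuperconductivity-20437), stub (b), WEIGHTED lines `j ≥ 1`:
# the scale-`n` TREE WEIGHT `klScaleWt … n` on a pair of lattice legs is below the product-torus moment weight, and the `klScaleWt`-weighted
# row / column sums of the sectorised slice covariance reduce to the weighted per-pair character sums (the `hrow`/`hcol` DICTIONARY)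

Cell `gate-hubbard-kl`, seat p3 (g9); located risk «(b)-Wt@j≥1» (KL STATUS plan g17 13:31:52Z), memo HOME/p3/g9/WT-DECAY-SCALES.md.  The weighted
determinant-bounded steps read the covariance `C′ = Sᵀ(F)·C^K_{(Λ,Λ′]}·S(F)` through
`hrow : ∀ Y, Σ_{Y′} ‖C′ Y Y′‖·wt{pos Y, pos Y′} ≤ α_w` with the scale-`n` tree weight `wt = klScaleWt L M β n` (`= 1 + Λ_n·d`,
`d = gridLabelDist L (4M) β`, positions `latticeLegPos (4M)`; `…EngineE4ScaleDoor` §1).  This file is pure bookkeeping between that currency and the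
weighted rows of `…SectorSliceRowsMoment`:

* §1 **`klScaleWt_pair_latticeLegPos_le`** — for two lattice legs `X = (x,ℓ)`, `Y = (y,ℓ′)`:
  `klScaleWt L M β n {pos X, pos Y} ≤ 1 + (Λ_nβ/(2M))·|(x₀ − y₀)~| + Λ_n·(|(x⃗ − y⃗)~₁| + |(x⃗ − y⃗)~₂|)` (doubling `circDist (4M) (2a) (2b) = 2·circDist (2M) a b`,
  `cyclicDist = |valMinAbs|`, and the `ℓ^∞ ≤ ℓ¹` step `torusSiteDist_le_abs_add_abs`); the right-hand side is the MOMENT WEIGHT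
  `w_n(z) = 1 + s₀|z̃₁| + s₁(|z̃₂,₁| + |z̃₂,₂|)` at `s₀ = Λ_nβ/(2M)`, `s₁ = Λ_n` of the master lemma `sum_wt_norm_charSum_le_of_third_differences`
  (up to `s₁|a| + s₁|b| = s₁(|a|+|b|)`); `momentWt_nonneg`, `momentWt_neg` (it is nonnegative and even);
* §2 **`rowSum_klScaleWt_sliceCT_le`** / **`colSum_klScaleWt_sliceCT_le`** — `Σ_{Y′} ‖C′ Y Y′‖·klScaleWt … n {pos Y, pos Y′} ≤ 8·Σ_{ω′} T_{w_n}(ω,ω′)` and the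
  column twin: the `hrow`/`hcol` hypotheses of the scale-`n` weighted step ARE sums of weighted per-pair character-sum `ℓ¹` norms, to which
  `…SectorSliceCharSumMoment.sliceCharSumWt_l1_le_of_data` applies pair by pair.

Everything is proved; no definitions, no named facts, no sorry.  Nothing asserts superconductivity.
-/

noncomputable section

namespace Summit.HubbardSuperconductivity.HubbardSuperconductivity.Theorems.EngineV8

set_option linter.dupNamespace false -- summit = problem name (single-conjunct summit), D-0017

open Real Finset Complex Literature.MathematicalPhysics.QuantumLattice Literature.Probability.LatticeModels
open Literature.Probability.LatticeModels.BattleFederbush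
open Summit.HubbardSuperconductivity.HubbardSuperconductivity.Theorems.KLRegimeSplit
open Summit.HubbardSuperconductivity.HubbardSuperconductivity.Theorems.KLProgrammeLegKernels
open Summit.HubbardSuperconductivity.HubbardSuperconductivity.Theorems.TorusFourierL2

variable {L M Ns : ℕ} [NeZero L] [NeZero M]

/-! ## §1 The tree weight on a pair of lattice legs versus the moment weight -/

/-- `cyclicDist_N(a, b) = |(a − b)~|` (local copy). -/
private theorem cyclicDist_eq_abs_valMinAbs_sub_loc {N : ℕ} [NeZero N] (a b : ZMod N) :
    cyclicDist N a b = |(((a - b).valMinAbs : ℤ) : ℝ)| := by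
  rw [cyclicDist, ← ZMod.valMinAbs_natAbs_eq_min, Nat.cast_natAbs, Int.cast_abs]

omit [NeZero L] in
/-- **Doubling of the time distance**: on the `4M`-grid two lattice times `2x₀`, `2y₀` are at cyclic distance `2·|(x₀ − y₀)~|` (centred
representative in `ℤ/2M`). -/
theorem cyclicDist_latticeTime_eq (x y : SpaceTimeIdx L M) :
    cyclicDist (2 * (2 * M)) (((2 * (x.1 : ℕ) : ℕ) : ZMod (2 * (2 * M)))) (((2 * (y.1 : ℕ) : ℕ) : ZMod (2 * (2 * M)))) =
      2 * |(((((x.1 : ℕ) : ZMod (2 * M)) - ((y.1 : ℕ) : ZMod (2 * M))).valMinAbs : ℤ) : ℝ)| := by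
  haveI : NeZero (2 * (2 * M)) := ⟨by have := NeZero.ne M; omega⟩
  have hM : 0 < 2 * M := by have := NeZero.ne M; omega
  rw [← circDist_eq_cyclicDist, circDist_two_mul (2 * M) _ _ hM, Nat.cast_mul, Nat.cast_two, circDist_eq_cyclicDist,
    cyclicDist_eq_abs_valMinAbs_sub_loc]

/-- **The scale-`n` tree weight on a pair of lattice legs is below the moment weight**:
`klScaleWt L M β n {pos X, pos Y} ≤ 1 + (Λ_nβ/(2M))·|(x₀ − y₀)~| + Λ_n|(x⃗ − y⃗)~₁| + Λ_n|(x⃗ − y⃗)~₂|` (`0 ≤ β`; in fact equality in the time part and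
`ℓ^∞ ≤ ℓ¹` in space). -/
theorem klScaleWt_pair_latticeLegPos_le {β : ℝ} (hβ : 0 ≤ β) (n : ℕ) (X Y : SpaceTimeIdx L M × SectorLeg Ns) :
    klScaleWt L M β n {latticeLegPos (2 * (2 * M)) X, latticeLegPos (2 * (2 * M)) Y} ≤
      1 + klScale klE0 n * β / (2 * M) * |(((((X.1.1 : ℕ) : ZMod (2 * M)) - ((Y.1.1 : ℕ) : ZMod (2 * M))).valMinAbs : ℤ) : ℝ)| +
        klScale klE0 n * |((((X.1.2 - Y.1.2) 0).valMinAbs : ℤ) : ℝ)| + klScale klE0 n * |((((X.1.2 - Y.1.2) 1).valMinAbs : ℤ) : ℝ)| := by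
  haveI : NeZero (2 * (2 * M)) := ⟨by have := NeZero.ne M; omega⟩
  have hΛ : 0 ≤ klScale klE0 n := (klth_klScale_pos n).le
  have hM0 : (0 : ℝ) < M := by exact_mod_cast Nat.pos_of_ne_zero (NeZero.ne M)
  rw [klScaleWt_apply, labelDiam_pair (isLabelDist_gridLabelDist L (2 * (2 * M)) hβ), latticeLegPos_apply, latticeLegPos_apply,
    gridLabelDist_apply]
  dsimp only
  rw [cyclicDist_latticeTime_eq]
  have hsp := torusSiteDist_le_abs_add_abs X.1.2 Y.1.2
  have hN : (((2 * (2 * M) : ℕ) : ℝ)) = 4 * M := by push_cast; ring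
  rw [hN]
  have htime : β / (4 * (M : ℝ)) * (2 * |(((((X.1.1 : ℕ) : ZMod (2 * M)) - ((Y.1.1 : ℕ) : ZMod (2 * M))).valMinAbs : ℤ) : ℝ)|) =
      β / (2 * M) * |(((((X.1.1 : ℕ) : ZMod (2 * M)) - ((Y.1.1 : ℕ) : ZMod (2 * M))).valMinAbs : ℤ) : ℝ)| := by
    field_simp
    ring
  rw [htime]
  have h1 : klScale klE0 n * (β / (2 * M) * |(((((X.1.1 : ℕ) : ZMod (2 * M)) - ((Y.1.1 : ℕ) : ZMod (2 * M))).valMinAbs : ℤ) : ℝ)| +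
      torusSiteDist X.1.2 Y.1.2) ≤
      klScale klE0 n * (β / (2 * M) * |(((((X.1.1 : ℕ) : ZMod (2 * M)) - ((Y.1.1 : ℕ) : ZMod (2 * M))).valMinAbs : ℤ) : ℝ)| +
      (|((((X.1.2 - Y.1.2) 0).valMinAbs : ℤ) : ℝ)| + |((((X.1.2 - Y.1.2) 1).valMinAbs : ℤ) : ℝ)|)) :=
    mul_le_mul_of_nonneg_left (by linarith) hΛ
  calc 1 + klScale klE0 n * (β / (2 * M) * |(((((X.1.1 : ℕ) : ZMod (2 * M)) - ((Y.1.1 : ℕ) : ZMod (2 * M))).valMinAbs : ℤ) : ℝ)| +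
        torusSiteDist X.1.2 Y.1.2)
      ≤ 1 + klScale klE0 n * (β / (2 * M) * |(((((X.1.1 : ℕ) : ZMod (2 * M)) - ((Y.1.1 : ℕ) : ZMod (2 * M))).valMinAbs : ℤ) : ℝ)| +
        (|((((X.1.2 - Y.1.2) 0).valMinAbs : ℤ) : ℝ)| + |((((X.1.2 - Y.1.2) 1).valMinAbs : ℤ) : ℝ)|)) := by linarith
    _ = _ := by ring

omit [NeZero L] in
/-- **The moment weight is nonnegative** (`0 ≤ s₀, s₁`). -/
theorem momentWt_nonneg {P : ℕ} {s₀ s₁ : ℝ} (hs₀ : 0 ≤ s₀) (hs₁ : 0 ≤ s₁) (z : TorusSite 1 P × TorusSite 2 L) :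
    0 ≤ 1 + s₀ * |(((z.1 0).valMinAbs : ℤ) : ℝ)| + s₁ * |(((z.2 0).valMinAbs : ℤ) : ℝ)| + s₁ * |(((z.2 1).valMinAbs : ℤ) : ℝ)| := by
  positivity

/-- `|(−a)~| = |ã|` on `ℤ/n`. -/
private theorem abs_valMinAbs_neg_cast {n : ℕ} [NeZero n] (a : ZMod n) :
    |(((-a).valMinAbs : ℤ) : ℝ)| = |((a.valMinAbs : ℤ) : ℝ)| := by
  rw [← Int.cast_abs, ← Int.cast_abs, ← Int.natCast_natAbs, ← Int.natCast_natAbs, ZMod.natAbs_valMinAbs_neg]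

/-- **The moment weight is even**: `w(−a, −b) = w(a, b)`. -/
theorem momentWt_neg {P : ℕ} [NeZero P] (s₀ s₁ : ℝ) (a : TorusSite 1 P) (b : TorusSite 2 L) :
    1 + s₀ * |((((-a) 0).valMinAbs : ℤ) : ℝ)| + s₁ * |((((-b) 0).valMinAbs : ℤ) : ℝ)| + s₁ * |((((-b) 1).valMinAbs : ℤ) : ℝ)| =
      1 + s₀ * |(((a 0).valMinAbs : ℤ) : ℝ)| + s₁ * |(((b 0).valMinAbs : ℤ) : ℝ)| + s₁ * |(((b 1).valMinAbs : ℤ) : ℝ)| := by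
  simp only [Pi.neg_apply, abs_valMinAbs_neg_cast]

/-! ## §2 The `klScaleWt`-weighted row and column sums of the sectorised slice covariance -/

/-- **`hrow` in `klScaleWt` currency**: for `C′ = Sᵀ(F)·C^K_{(Λ,Λ′]}·S(F)` on an admissible frame, `0 < β`, every scale `n` and every lattice leg
`Y = (x, ((ω,σ),c))`,
`Σ_{Y′} ‖C′ Y Y′‖·klScaleWt L M β n {pos Y, pos Y′} ≤ 8·Σ_{ω′} Σ_z w_n(z)·‖Σ_q χ_{q₁}(z₁)χ_{q₂}(z₂) • G_{ωω′}(q)‖`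
with the moment weight `w_n(z) = 1 + (Λ_nβ/(2M))|z̃₁| + Λ_n|z̃₂,₁| + Λ_n|z̃₂,₂|` and the per-pair symbol `G_{ωω′}` of `…SectorSliceRows`.
[cite: BenfattoGiulianiMastropietro2006, §2.7 (2.66)–(2.67), (3.3)] -/
theorem rowSum_klScaleWt_sliceCT_le {β : ℝ} (hβ : 0 < β) (μ : ℝ) (K : TrigPolyC4v) (Λ Λ' : ℝ) (n : ℕ)
    (F : Fin Ns → FreqMomentum L M → ℂ) (Y : SpaceTimeIdx L M × SectorLeg Ns) :
    ∑ Y' : SpaceTimeIdx L M × SectorLeg Ns,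
        ‖((sectorSubMatrix L M β F).transpose * hubbardCovSliceCT L M β μ 0 K Λ Λ' * sectorSubMatrix L M β F) Y Y'‖ *
          klScaleWt L M β n {latticeLegPos (2 * (2 * M)) Y, latticeLegPos (2 * (2 * M)) Y'} ≤
      8 * ∑ ω' : Fin Ns, ∑ z : TorusSite 1 (2 * M) × TorusSite 2 L,
        (1 + klScale klE0 n * β / (2 * M) * |(((z.1 0).valMinAbs : ℤ) : ℝ)| + klScale klE0 n * |(((z.2 0).valMinAbs : ℤ) : ℝ)| +
          klScale klE0 n * |(((z.2 1).valMinAbs : ℤ) : ℝ)|) *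
        ‖∑ q : TorusSite 1 (2 * M) × TorusSite 2 L, (torusChar q.1 z.1 * torusChar q.2 z.2) •
          ((((1 / (β * (L : ℝ) ^ 2) : ℝ) : ℂ) ^ 2 *
            (F Y.2.1.1 (⟨(q.1 0).val, ZMod.val_lt (q.1 0)⟩, q.2) * F ω' (⟨(q.1 0).val, ZMod.val_lt (q.1 0)⟩, q.2) *
              sliceSymbolFnXi (β * (L : ℝ) ^ 2) 0 Λ Λ' (matsubaraFreq β M ⟨(q.1 0).val, ZMod.val_lt (q.1 0)⟩)
                (nambuXiCT L μ K q.2))))‖ := by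
  have hΛ : 0 ≤ klScale klE0 n := (klth_klScale_pos n).le
  have hs₀ : 0 ≤ klScale klE0 n * β / (2 * M) := by positivity
  -- the moment weight as a function on the product torus
  set w : TorusSite 1 (2 * M) × TorusSite 2 L → ℝ := fun z =>
    1 + klScale klE0 n * β / (2 * M) * |(((z.1 0).valMinAbs : ℤ) : ℝ)| + klScale klE0 n * |(((z.2 0).valMinAbs : ℤ) : ℝ)| +
      klScale klE0 n * |(((z.2 1).valMinAbs : ℤ) : ℝ)| with hw
  have hw0 : ∀ z, 0 ≤ w z := fun z => momentWt_nonneg hs₀ hΛ z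
  have hweven : ∀ a b, w (-a, -b) = w (a, b) := fun a b => by simp only [hw]; exact momentWt_neg _ _ a b
  have hrows := rowSumWt_norm_pullback_sliceCT_le hβ.ne' μ K Λ Λ' F w hw0 hweven Y
  refine le_trans (Finset.sum_le_sum fun Y' _ => mul_le_mul_of_nonneg_left ?_ (norm_nonneg _)) hrows
  -- the tree weight on the pair is below the moment weight at the difference
  have h := klScaleWt_pair_latticeLegPos_le (L := L) (M := M) hβ.le n Y Y'
  simp only [hw]
  exact h

/-- **`hcol` in `klScaleWt` currency**: the column twin (symbol read at the spin of `Y′`). -/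
theorem colSum_klScaleWt_sliceCT_le {β : ℝ} (hβ : 0 < β) (μ : ℝ) (K : TrigPolyC4v) (Λ Λ' : ℝ) (n : ℕ)
    (F : Fin Ns → FreqMomentum L M → ℂ) (Y' : SpaceTimeIdx L M × SectorLeg Ns) :
    ∑ Y : SpaceTimeIdx L M × SectorLeg Ns,
        ‖((sectorSubMatrix L M β F).transpose * hubbardCovSliceCT L M β μ 0 K Λ Λ' * sectorSubMatrix L M β F) Y Y'‖ *
          klScaleWt L M β n {latticeLegPos (2 * (2 * M)) Y, latticeLegPos (2 * (2 * M)) Y'} ≤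
      8 * ∑ ω : Fin Ns, ∑ z : TorusSite 1 (2 * M) × TorusSite 2 L,
        (1 + klScale klE0 n * β / (2 * M) * |(((z.1 0).valMinAbs : ℤ) : ℝ)| + klScale klE0 n * |(((z.2 0).valMinAbs : ℤ) : ℝ)| +
          klScale klE0 n * |(((z.2 1).valMinAbs : ℤ) : ℝ)|) *
        ‖∑ q : TorusSite 1 (2 * M) × TorusSite 2 L, (torusChar q.1 z.1 * torusChar q.2 z.2) •
          ((((1 / (β * (L : ℝ) ^ 2) : ℝ) : ℂ) ^ 2 *
            (F ω (⟨(q.1 0).val, ZMod.val_lt (q.1 0)⟩, q.2) * F Y'.2.1.1 (⟨(q.1 0).val, ZMod.val_lt (q.1 0)⟩, q.2) *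
              sliceSymbolFnXi (β * (L : ℝ) ^ 2) 0 Λ Λ' (matsubaraFreq β M ⟨(q.1 0).val, ZMod.val_lt (q.1 0)⟩)
                (nambuXiCT L μ K q.2))))‖ := by
  have hΛ : 0 ≤ klScale klE0 n := (klth_klScale_pos n).le
  have hs₀ : 0 ≤ klScale klE0 n * β / (2 * M) := by positivity
  set w : TorusSite 1 (2 * M) × TorusSite 2 L → ℝ := fun z =>
    1 + klScale klE0 n * β / (2 * M) * |(((z.1 0).valMinAbs : ℤ) : ℝ)| + klScale klE0 n * |(((z.2 0).valMinAbs : ℤ) : ℝ)| +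
      klScale klE0 n * |(((z.2 1).valMinAbs : ℤ) : ℝ)| with hw
  have hw0 : ∀ z, 0 ≤ w z := fun z => momentWt_nonneg hs₀ hΛ z
  have hweven : ∀ a b, w (-a, -b) = w (a, b) := fun a b => by simp only [hw]; exact momentWt_neg _ _ a b
  have hcols := colSumWt_norm_pullback_sliceCT_le hβ.ne' μ K Λ Λ' F w hw0 hweven Y'
  refine le_trans (Finset.sum_le_sum fun Y _ => mul_le_mul_of_nonneg_left ?_ (norm_nonneg _)) hcols
  have h := klScaleWt_pair_latticeLegPos_le (L := L) (M := M) hβ.le n Y Y'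
  simp only [hw]
  exact h

end Summit.HubbardSuperconductivity.HubbardSuperconductivity.Theorems.EngineV8

end
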